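import Mathlib
import Summits.ValiantsHypothesis.ValiantsHypothesis.Theorems.ValuativeGCTHeadFlipRankBoundDefs
import Summits.ValiantsHypothesis.ValiantsHypothesis.Theorems.ValuativeGCTHeadFlipRankBoundESymm
import Summits.ValiantsHypothesis.ValiantsHypothesis.Theorems.ValuativeGCTHeadFlipRankBoundPoints
import Summits.ValiantsHypothesis.ValiantsHypothesis.Theorems.ValuativeGCTValuativeFlipRankOneMaster
import Summits.ValiantsHypothesis.ValiantsHypothesis.Theorems.ValuativeGCTValuativeFlipRankOneV1

/-!
# `B`-relations of the rank-one moment-curve pencil are spanned by the swap relations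
# (crux `ValuativeGCT.ValuativeFlip`, stub `stub_fourRowPencilRank`; the new ingredient of the
# four-multiplier count)

Wall-breaker k1 (explicit per-side constructions), crux stmt-ValiantsHypothesis-12624, line
`four-row-count`.  Third file of the four-multiplier count for the rank-one moment-curve pencil
`M(y) = diag(d_k) + u·1ᵀ` (`d_k = a_k y₀ + y₃`, `u_k = a_k² y₁ + a_k³ y₂`): a relation
`Σ_ab M_ab·Per_ab = 0` with multipliers in `B = ⟨y₁, y₂⟩` only (`M_ab = α_ab y₁ + β_ab y₂`).  The swap
relations `u_c Per_cb - u_b Per_bc = 0` (`Per_cb = u_b F_cb` with `F` symmetric) are such relations; we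
show they are all of them, in the form needed by the count: **if the `y₁`-coefficients `α_cb` vanish for
all `c < b`, the relation is trivial** (`mcp_B_relations`).  Proof: the `B`-only master identity
`Σ_a M_aa Ψ({a}) = Σ_{a≠b} M_ab u_b Ψ({a,b})` (`mcp_MI`), evaluated at the points `z_{cb}(α₀,β₀)` where
the cubic `a ↦ y₃ + y₀a - y₁a² - y₂a³` is `(a-a_c)(a-a_b)(α₀ a+β₀)`, isolates the swap quadratic
`q'_cb = M_cb u_b + M_bc u_c`; three admissible `(α₀:β₀)` kill its three coefficients
(`mcp_B_pair_coeffs`), which pins `(M_cb, M_bc)` to the swap line and to `0` once `α_cb = 0`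
(`mcp_B_pair_zero`, via the HeadFlip line's `stub_rbV4`); the diagonal then dies at the two points
`z_c`, `z'_c` (`mcp_B_diag_zero`).  No definitions. [this crux; new]
-/

-- `Summit.ValiantsHypothesis.ValiantsHypothesis.…` is the tree's mandated single-conjunct layout (Sub = Summit).
set_option linter.dupNamespace false

namespace Summit.ValiantsHypothesis.ValiantsHypothesis.Theorems.ValuativeFlip

open MvPolynomial Finset
open scoped BigOperators
open Summit.ValiantsHypothesis.ValiantsHypothesis.Theorems.HeadFlip

noncomputable section

/-! ### The `B`-only master identity -/

/-- A linear form `x·y₁ + x'·y₂` in the `B`-variables is weighted-homogeneous of `B`-weight `1`. [folklore] -/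
theorem mcp_linB_isWeightedHomogeneous (x x' : ℂ) :
    MvPolynomial.IsWeightedHomogeneous (![0, 1, 1, 0] : Fin 4 → ℕ)
      (x • (X 1 : MvPolynomial (Fin 4) ℂ) + x' • (X 2 : MvPolynomial (Fin 4) ℂ)) 1 := by
  have h1 : MvPolynomial.IsWeightedHomogeneous (![0, 1, 1, 0] : Fin 4 → ℕ) (X 1 : MvPolynomial (Fin 4) ℂ) 1 := by
    simpa using isWeightedHomogeneous_X ℂ (![0, 1, 1, 0] : Fin 4 → ℕ) 1
  have h2 : MvPolynomial.IsWeightedHomogeneous (![0, 1, 1, 0] : Fin 4 → ℕ) (X 2 : MvPolynomial (Fin 4) ℂ) 1 := by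
    simpa using isWeightedHomogeneous_X ℂ (![0, 1, 1, 0] : Fin 4 → ℕ) 2
  rw [smul_eq_C_mul, smul_eq_C_mul]
  exact (h1.C_mul x).add (h2.C_mul x')

/-- **The `B`-only master identity.**  A relation `Σ_ab M_ab·Per_ab = 0` whose coefficients
`M_ab = α_ab y₁ + β_ab y₂` are linear forms in the `B`-variables satisfies
`Σ_a M_aa Ψ({a}) - Σ_{a≠b} M_ab u_b Ψ({a,b}) = 0` (`mcp_master` with `L = 0`). [this crux; new] -/
theorem mcp_MI {n : ℕ} (α β : Fin n → Fin n → ℂ)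
    (hrel : ∑ a, ∑ b, (α a b • (X 1 : MvPolynomial (Fin 4) ℂ) + β a b • (X 2 : MvPolynomial (Fin 4) ℂ)) * rbPer a b = 0) :
    (∑ a, (α a a • (X 1 : MvPolynomial (Fin 4) ℂ) + β a a • (X 2 : MvPolynomial (Fin 4) ℂ)) * rbPsi {a}) -
      ∑ a, ∑ b ∈ Finset.univ.erase a,
        (α a b • (X 1 : MvPolynomial (Fin 4) ℂ) + β a b • (X 2 : MvPolynomial (Fin 4) ℂ)) * rbU b * rbPsi {a, b} = 0 := by
  have h := mcp_master (fun _ _ => (0 : MvPolynomial (Fin 4) ℂ))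
    (fun a b => α a b • (X 1 : MvPolynomial (Fin 4) ℂ) + β a b • (X 2 : MvPolynomial (Fin 4) ℂ))
    (fun _ _ => isWeightedHomogeneous_zero ℂ _ 0) (fun a b => mcp_linB_isWeightedHomogeneous (α a b) (β a b))
    (by simpa only [zero_add] using hrel)
  simpa only [add_zero, zero_mul, Finset.sum_const_zero, sub_zero, zero_add] using h

/-! ### Evaluation at the points `z_{cb}(α₀, β₀)` -/

/-- At the point `z_{cb}(α₀,β₀) = (pα₀ - sβ₀, sα₀ - β₀, -α₀, pβ₀)` (`s = a_c + a_b`, `p = a_c a_b`; the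
cubic `a ↦ y₃ + y₀ a - y₁ a² - y₂ a³` there is `(a - a_c)(a - a_b)(α₀ a + β₀)`):
`(d_l - u_l)(z) = (a_l - a_c)(a_l - a_b)(α₀ a_l + β₀)`. [this crux] -/
theorem mcp_DU_eval_z {n : ℕ} (c b l : Fin n) (α₀ β₀ : ℂ) :
    MvPolynomial.eval ![rbA c * rbA b * α₀ - (rbA c + rbA b) * β₀, (rbA c + rbA b) * α₀ - β₀, -α₀, rbA c * rbA b * β₀]
      (rbD l - rbU l) = (rbA l - rbA c) * (rbA l - rbA b) * (α₀ * rbA l + β₀) := by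
  simp only [rbD, rbU, rbDv, rbUv, map_sub, Fin.sum_univ_four, Matrix.cons_val_zero, Matrix.cons_val_one,
    Matrix.head_cons, Matrix.cons_val_two, Matrix.tail_cons, Matrix.cons_val_three, map_add,
    MvPolynomial.smul_eval, MvPolynomial.eval_X]
  ring

/-- `Ψ(S)(z_{cb}) = 0` as soon as `c ∉ S` or `b ∉ S` (a vanishing factor `d_c - u_c` or `d_b - u_b`). [this crux] -/
theorem mcp_Psi_eval_z_eq_zero {n : ℕ} (c b : Fin n) (α₀ β₀ : ℂ) (S : Finset (Fin n))
    (hS : c ∉ S ∨ b ∉ S) :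
    MvPolynomial.eval ![rbA c * rbA b * α₀ - (rbA c + rbA b) * β₀, (rbA c + rbA b) * α₀ - β₀, -α₀, rbA c * rbA b * β₀]
      (rbPsi S) = 0 := by
  rw [rbPsi, map_prod]
  rcases hS with h | h
  · exact Finset.prod_eq_zero (Finset.mem_sdiff.2 ⟨Finset.mem_univ _, h⟩) (by rw [mcp_DU_eval_z]; ring)
  · exact Finset.prod_eq_zero (Finset.mem_sdiff.2 ⟨Finset.mem_univ _, h⟩) (by rw [mcp_DU_eval_z]; ring)

/-- `Ψ({c,b})(z_{cb}) ≠ 0` as long as `α₀ a_l + β₀ ≠ 0` for every `l ∉ {c, b}`. [this crux] -/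
theorem mcp_Psi_pair_eval_z_ne_zero {n : ℕ} {c b : Fin n} (α₀ β₀ : ℂ)
    (hadm : ∀ l, l ≠ c → l ≠ b → α₀ * rbA l + β₀ ≠ 0) :
    MvPolynomial.eval ![rbA c * rbA b * α₀ - (rbA c + rbA b) * β₀, (rbA c + rbA b) * α₀ - β₀, -α₀, rbA c * rbA b * β₀]
      (rbPsi {c, b}) ≠ 0 := by
  rw [rbPsi, map_prod]
  refine Finset.prod_ne_zero_iff.2 fun l hl => ?_
  simp only [Finset.mem_sdiff, Finset.mem_univ, true_and, Finset.mem_insert, Finset.mem_singleton,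
    not_or] at hl
  rw [mcp_DU_eval_z]
  exact mul_ne_zero (mul_ne_zero (sub_ne_zero.2 (rbA_injective.ne hl.1))
    (sub_ne_zero.2 (rbA_injective.ne hl.2))) (hadm l hl.1 hl.2)

/-- **The swap quadratic vanishes at the admissible points `z_{cb}(α₀,β₀)`.**  For a `B`-relation
and `c ≠ b`, the binary quadratic `q'_{cb} = M_cb u_b + M_bc u_c` vanishes at `z_{cb}(α₀,β₀)` whenever
`α₀ a_l + β₀ ≠ 0` for all `l ∉ {c,b}`: evaluate the `B`-only master identity there — every `Ψ({a})`
vanishes, and `Ψ({a,a'})` survives only for `{a,a'} = {c,b}`. [this crux; new] -/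
theorem mcp_qB_eval_z {n : ℕ} (α β : Fin n → Fin n → ℂ)
    (hrel : ∑ a, ∑ b, (α a b • (X 1 : MvPolynomial (Fin 4) ℂ) + β a b • (X 2 : MvPolynomial (Fin 4) ℂ)) * rbPer a b = 0)
    {c b : Fin n} (hcb : c ≠ b) (α₀ β₀ : ℂ) (hadm : ∀ l, l ≠ c → l ≠ b → α₀ * rbA l + β₀ ≠ 0) :
    MvPolynomial.eval ![rbA c * rbA b * α₀ - (rbA c + rbA b) * β₀, (rbA c + rbA b) * α₀ - β₀, -α₀, rbA c * rbA b * β₀]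
      ((α c b • (X 1 : MvPolynomial (Fin 4) ℂ) + β c b • (X 2 : MvPolynomial (Fin 4) ℂ)) * rbU b +
        (α b c • (X 1 : MvPolynomial (Fin 4) ℂ) + β b c • (X 2 : MvPolynomial (Fin 4) ℂ)) * rbU c) = 0 := by
  set z : Fin 4 → ℂ := ![rbA c * rbA b * α₀ - (rbA c + rbA b) * β₀, (rbA c + rbA b) * α₀ - β₀, -α₀,
    rbA c * rbA b * β₀] with hz
  set M : Fin n → Fin n → MvPolynomial (Fin 4) ℂ :=
    fun a a' => α a a' • (X 1 : MvPolynomial (Fin 4) ℂ) + β a a' • (X 2 : MvPolynomial (Fin 4) ℂ) with hM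
  have hMI := congrArg (MvPolynomial.eval z) (mcp_MI α β hrel)
  rw [map_zero, map_sub] at hMI
  -- the singleton sum vanishes at `z`
  have h1 : MvPolynomial.eval z (∑ a, M a a * rbPsi {a}) = 0 := by
    rw [map_sum]
    refine Finset.sum_eq_zero fun a _ => ?_
    rw [map_mul, hz, mcp_Psi_eval_z_eq_zero c b α₀ β₀ {a} ?_, mul_zero]
    by_contra h
    push Not at h
    simp only [Finset.mem_singleton] at h
    exact hcb (h.1.trans h.2.symm)
  -- the pair sum collapses to the two orderings of `{c, b}`
  have h2 : MvPolynomial.eval z (∑ a, ∑ a' ∈ Finset.univ.erase a, M a a' * rbU a' * rbPsi {a, a'}) =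
      MvPolynomial.eval z (M c b * rbU b + M b c * rbU c) * MvPolynomial.eval z (rbPsi {c, b}) := by
    simp only [map_sum]
    rw [mcp_sum2_collapse (fun a a' => MvPolynomial.eval z (M a a' * rbU a' * rbPsi {a, a'})) hcb]
    · rw [Finset.pair_comm b c]
      simp only [map_add, map_mul]
      ring
    · intro a a' _ hne
      rw [map_mul, hz, mcp_Psi_eval_z_eq_zero c b α₀ β₀ {a, a'} ?_, mul_zero]
      by_contra h
      push Not at h
      apply hne
      refine (Finset.eq_of_subset_of_card_le ?_ ?_).symm
      · intro x hx
        simp only [Finset.mem_insert, Finset.mem_singleton] at hx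
        rcases hx with h' | h' <;> rw [h']
        · exact h.1
        · exact h.2
      · rw [Finset.card_pair hcb]
        exact Finset.card_le_two
  have hM' : (∑ a, M a a * rbPsi {a}) = ∑ a, (α a a • (X 1 : MvPolynomial (Fin 4) ℂ) + β a a • (X 2 : MvPolynomial (Fin 4) ℂ)) * rbPsi {a} := rfl
  have hM'' : (∑ a, ∑ a' ∈ Finset.univ.erase a, M a a' * rbU a' * rbPsi {a, a'}) =
      ∑ a, ∑ b ∈ Finset.univ.erase a,
        (α a b • (X 1 : MvPolynomial (Fin 4) ℂ) + β a b • (X 2 : MvPolynomial (Fin 4) ℂ)) * rbU b * rbPsi {a, b} := rfl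
  rw [← hM', ← hM'', h1, h2, zero_sub, neg_eq_zero] at hMI
  exact (mul_eq_zero.1 hMI).resolve_right (mcp_Psi_pair_eval_z_ne_zero α₀ β₀ hadm)

/-- The swap quadratic evaluated at an arbitrary point, in coordinates. [this crux] -/
theorem mcp_qB_eval {n : ℕ} (c b : Fin n) (x₁ x₂ x₃ x₄ : ℂ) (y : Fin 4 → ℂ) :
    MvPolynomial.eval y ((x₁ • (X 1 : MvPolynomial (Fin 4) ℂ) + x₂ • (X 2 : MvPolynomial (Fin 4) ℂ)) * rbU b +
        (x₃ • (X 1 : MvPolynomial (Fin 4) ℂ) + x₄ • (X 2 : MvPolynomial (Fin 4) ℂ)) * rbU c) =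
      (x₁ * y 1 + x₂ * y 2) * (rbA b ^ 2 * y 1 + rbA b ^ 3 * y 2) +
        (x₃ * y 1 + x₄ * y 2) * (rbA c ^ 2 * y 1 + rbA c ^ 3 * y 2) := by
  simp only [rbU, rbUv, Fin.sum_univ_four, Matrix.cons_val_zero, Matrix.cons_val_one, Matrix.head_cons,
    Matrix.cons_val_two, Matrix.tail_cons, Matrix.cons_val_three, map_add, map_mul,
    MvPolynomial.smul_eval, MvPolynomial.eval_X]
  ring

/-- **The three coefficient identities of a `B`-relation on a pair `c ≠ b`** (the swap quadratic
`q'_{cb} = γ₁ y₁² + γ₂ y₁y₂ + γ₃ y₂²` vanishes identically: it vanishes at the three admissible points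
`z_{cb}(1,0)`, `z_{cb}(0,1)`, `z_{cb}(1,1)`, whose `(y₁ : y₂)` are pairwise distinct). [this crux; new] -/
theorem mcp_B_pair_coeffs {n : ℕ} (α β : Fin n → Fin n → ℂ)
    (hrel : ∑ a, ∑ b, (α a b • (X 1 : MvPolynomial (Fin 4) ℂ) + β a b • (X 2 : MvPolynomial (Fin 4) ℂ)) * rbPer a b = 0)
    {c b : Fin n} (hcb : c ≠ b) :
    α c b * rbA b ^ 2 + α b c * rbA c ^ 2 = 0 ∧
    α c b * rbA b ^ 3 + β c b * rbA b ^ 2 + α b c * rbA c ^ 3 + β b c * rbA c ^ 2 = 0 ∧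
    β c b * rbA b ^ 3 + β b c * rbA c ^ 3 = 0 := by
  have hpos : ∀ l : Fin n, ∀ m : ℕ, rbA l + m ≠ 0 := by
    intro l m
    rw [rbA_eq_natCast, ← Nat.cast_add]
    exact Nat.cast_ne_zero.2 (by omega)
  have h10 := mcp_qB_eval_z α β hrel hcb 1 0 (fun l _ _ => by simpa using rbA_ne_zero l)
  have h01 := mcp_qB_eval_z α β hrel hcb 0 1 (fun l _ _ => by simp)
  have h11 := mcp_qB_eval_z α β hrel hcb 1 1 (fun l _ _ => by simpa using hpos l 1)
  rw [mcp_qB_eval] at h10 h01 h11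
  simp only [Matrix.cons_val_zero, Matrix.cons_val_one, Matrix.head_cons, Matrix.cons_val_two, Matrix.tail_cons,
    mul_one, mul_zero, sub_zero, zero_sub] at h10 h01 h11
  refine ⟨?_, ?_, ?_⟩
  · linear_combination h01
  · linear_combination h11 - h10 + (2 * (rbA c + rbA b) - 1) * h01
  · linear_combination (rbA c + rbA b) * h11 + (1 - (rbA c + rbA b)) * h10 +
      ((rbA c + rbA b) ^ 2 - (rbA c + rbA b)) * h01

/-- **A `B`-relation with vanishing `y₁`-coefficient `α_cb` vanishes on the whole pair `{c,b}`.**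
[this crux; new] -/
theorem mcp_B_pair_zero {n : ℕ} (α β : Fin n → Fin n → ℂ)
    (hrel : ∑ a, ∑ b, (α a b • (X 1 : MvPolynomial (Fin 4) ℂ) + β a b • (X 2 : MvPolynomial (Fin 4) ℂ)) * rbPer a b = 0)
    {c b : Fin n} (hcb : c ≠ b) (hθ : α c b = 0) :
    β c b = 0 ∧ α b c = 0 ∧ β b c = 0 := by
  obtain ⟨h1, h2, h3⟩ := mcp_B_pair_coeffs α β hrel hcb
  rw [hθ, zero_mul, zero_add] at h1
  have hαbc : α b c = 0 := (mul_eq_zero.1 h1).resolve_right (pow_ne_zero _ (rbA_ne_zero c))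
  rw [hθ, hαbc] at h2
  obtain ⟨hx, hx'⟩ := stub_rbV4 c b hcb (β c b) (β b c) (by linear_combination h2) (by linear_combination h3)
  exact ⟨hx, hαbc, hx'⟩

/-! ### The diagonal coefficients -/

/-- At `z'_c = (2 - 3a_c, a_c - 3, -1, -2a_c)` (cubic `(a - a_c)(a + 1)(a + 2)`):
`(d_l - u_l)(z'_c) = (a_l - a_c)(a_l + 1)(a_l + 2)`. [this crux] -/
theorem mcp_DU_eval_zc' {n : ℕ} (c l : Fin n) :
    MvPolynomial.eval ![2 - 3 * rbA c, rbA c - 3, -1, -2 * rbA c] (rbD l - rbU l) =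
      (rbA l - rbA c) * (rbA l + 1) * (rbA l + 2) := by
  simp only [rbD, rbU, rbDv, rbUv, map_sub, Fin.sum_univ_four, Matrix.cons_val_zero, Matrix.cons_val_one,
    Matrix.head_cons, Matrix.cons_val_two, Matrix.tail_cons, Matrix.cons_val_three, map_add,
    MvPolynomial.smul_eval, MvPolynomial.eval_X]
  ring

/-- **Diagonal coefficients of a `B`-relation vanish once the off-diagonal ones do.**  Then
`Σ_a M_aa Ψ({a}) = 0`; at `z_c = (1, a_c, -1, -a_c)` and at `z'_c` every `Ψ({a})`, `a ≠ c`, vanishes and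
`Ψ({c})` does not, so `M_cc(z_c) = M_cc(z'_c) = 0`, two independent conditions. [this crux; new] -/
theorem mcp_B_diag_zero {n : ℕ} (α β : Fin n → Fin n → ℂ)
    (hrel : ∑ a, ∑ b, (α a b • (X 1 : MvPolynomial (Fin 4) ℂ) + β a b • (X 2 : MvPolynomial (Fin 4) ℂ)) * rbPer a b = 0)
    (hoff : ∀ a b, a ≠ b → α a b = 0 ∧ β a b = 0) (c : Fin n) : α c c = 0 ∧ β c c = 0 := by
  have hMI := mcp_MI α β hrel
  have hoff' : (∑ a, ∑ b ∈ Finset.univ.erase a,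
      (α a b • (X 1 : MvPolynomial (Fin 4) ℂ) + β a b • (X 2 : MvPolynomial (Fin 4) ℂ)) * rbU b * rbPsi {a, b}) = 0 := by
    refine Finset.sum_eq_zero fun a _ => Finset.sum_eq_zero fun b hb => ?_
    obtain ⟨h1, h2⟩ := hoff a b (Finset.mem_erase.1 hb).1.symm
    rw [h1, h2, zero_smul, zero_smul, add_zero, zero_mul, zero_mul]
  rw [hoff', sub_zero] at hMI
  -- evaluation of the diagonal sum at a point killing every `Ψ({a})`, `a ≠ c`
  have heval : ∀ (z : Fin 4 → ℂ), (∀ l, MvPolynomial.eval z (rbD l - rbU l) = 0 ↔ l = c) →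
      α c c * z 1 + β c c * z 2 = 0 := by
    intro z hz
    have h := congrArg (MvPolynomial.eval z) hMI
    rw [map_zero, map_sum, Finset.sum_eq_single c] at h
    · rw [map_mul] at h
      have hne : MvPolynomial.eval z (rbPsi {c}) ≠ 0 := by
        rw [rbPsi, map_prod]
        refine Finset.prod_ne_zero_iff.2 fun l hl => ?_
        simp only [Finset.mem_sdiff, Finset.mem_univ, true_and, Finset.mem_singleton] at hl
        exact fun h0 => hl ((hz l).1 h0)
      have h' := (mul_eq_zero.1 h).resolve_right hne
      simpa [MvPolynomial.smul_eval, MvPolynomial.eval_X] using h'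
    · intro a _ hac
      rw [map_mul, rbPsi, map_prod,
        Finset.prod_eq_zero (Finset.mem_sdiff.2 ⟨Finset.mem_univ c, by simpa using Ne.symm hac⟩) ((hz c).2 rfl),
        mul_zero]
    · intro h
      exact absurd (Finset.mem_univ c) h
  have hsq : ∀ l : Fin n, rbA l ^ 2 + 1 ≠ 0 := by
    intro l
    rw [rbA_eq_natCast]
    norm_cast
  have hpos : ∀ l : Fin n, ∀ m : ℕ, rbA l + m ≠ 0 := by
    intro l m
    rw [rbA_eq_natCast, ← Nat.cast_add]
    exact Nat.cast_ne_zero.2 (by omega)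
  have e1 := heval ![1, rbA c, -1, -rbA c] fun l => by
    rw [rbDU_eval_zc]
    constructor
    · intro h
      rcases mul_eq_zero.1 h with h | h
      · exact rbA_injective (sub_eq_zero.1 h)
      · exact absurd h (hsq l)
    · intro h
      rw [h, sub_self, zero_mul]
  have e2 := heval ![2 - 3 * rbA c, rbA c - 3, -1, -2 * rbA c] fun l => by
    rw [mcp_DU_eval_zc']
    constructor
    · intro h
      rcases mul_eq_zero.1 h with h | h
      · rcases mul_eq_zero.1 h with h | h
        · exact rbA_injective (sub_eq_zero.1 h)
        · exact absurd h (by simpa using hpos l 1)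
      · exact absurd h (by simpa using hpos l 2)
    · intro h
      rw [h, sub_self, zero_mul, zero_mul]
  simp only [Matrix.cons_val_zero, Matrix.cons_val_one, Matrix.head_cons, Matrix.cons_val_two,
    Matrix.tail_cons] at e1 e2
  have hα : α c c = 0 := by linear_combination (e1 - e2) / 3
  refine ⟨hα, ?_⟩
  linear_combination rbA c * hα - e1

/-! ### The space of `B`-relations is controlled by the `C(n,2)` upper-triangular `y₁`-coefficients -/

/-- **`B`-relations (four-multiplier count, the new ingredient).**  A relation
`Σ_ab (α_ab y₁ + β_ab y₂)·Per_ab = 0` among the `2n²` products with multipliers `y₁, y₂` whose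
`y₁`-coefficients `α_cb` vanish for all `c < b` is trivial.  (So the `B`-relations are exactly the
span of the `C(n,2)` swap relations `u_c Per_cb = u_b Per_bc`, which have `α_cb = a_c² ≠ 0`.)
[this crux; new] -/
theorem mcp_B_relations : ∀ {n : ℕ} (α β : Fin n → Fin n → ℂ),
    (∑ a, ∑ b, (α a b • (X 1 : MvPolynomial (Fin 4) ℂ) + β a b • (X 2 : MvPolynomial (Fin 4) ℂ)) * rbPer a b = 0) →
    (∀ c b, c < b → α c b = 0) → α = 0 ∧ β = 0 := by
  intro n α β hrel hθ
  have hoff : ∀ a b, a ≠ b → α a b = 0 ∧ β a b = 0 := by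
    intro a b hab
    rcases lt_or_gt_of_ne hab with h | h
    · have hz := mcp_B_pair_zero α β hrel hab (hθ a b h)
      exact ⟨hθ a b h, hz.1⟩
    · have hz := mcp_B_pair_zero α β hrel (Ne.symm hab) (hθ b a h)
      exact ⟨hz.2.1, hz.2.2⟩
  have hdiag := mcp_B_diag_zero α β hrel hoff
  constructor
  · funext a b
    by_cases hab : a = b
    · subst hab; exact (hdiag a).1
    · exact (hoff a b hab).1
  · funext a b
    by_cases hab : a = b
    · subst hab; exact (hdiag a).2
    · exact (hoff a b hab).2

end

end Summit.ValiantsHypothesis.ValiantsHypothesis.Theorems.ValuativeFlip
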